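import Literature.NumberTheory.Automorphic.ShimuraCurveRibetTakahashiPairwiseEisensteinProofs
import Literature.NumberTheory.EllipticCurves.EichlerBasisTheoremOfTraceIdentity
import Literature.NumberTheory.EllipticCurves.TakahashiDegreeFormulaFromDictionary
import Literature.NumberTheory.EllipticCurves.TakahashiDegreeFormulaCoprimeProofs
import Literature.NumberTheory.Automorphic.BrandtAtkinLehnerSignCanonical
import Summits.ABC.ABC.Theorems.DefiniteXiDefiniteRTControlPrime
import HarnessLib

/-!
# Stub ideation k1, GEN 6 (FAMILY 1 — recognise & import) for `stub_takahashi`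
# (crux `DefiniteXi.DefiniteRTControlPrime`, stmt-ABC-11338): the MINIMAL verbatim import

Companion of `STUB-IDEAS-stub_takahashi-1.md` (gen 6).  Everything named `A*`/`S*` is PROVED here;
the three `def`s `H2flat`, `H1`, `H0` are the proposed leaves (texts to be typed VERBATIM as named
facts / proved), each the exact de-square-free-ification of an EXISTING reviewed declaration:

* `H2flat` = the section hypothesis `hDict` of
  `Literature/NumberTheory/Automorphic/ShimuraCurveRibetTakahashiPairwiseEisensteinProofs.lean`
  (ll. 358–390, six consumers under `include hDict`) with its rank-one conjunct REMOVED
  = `takahashi2001_characterGroupDictionary` (reviewed, `TakahashiDegreeFormulaFromDictionary.lean`)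
  with `Squarefree (M*r)` ↦ `M.Coprime r`, conductor-restricted minimality, `+` degree-zero clause;
* `H1` = `takahashi2001_brandtEigenLattice_rank_one` (reviewed, PROVED at square-free level:
  `takahashi2001_brandtEigenLattice_rank_one_holds`) with `Squarefree (M*r)` ↦ `M.Coprime r`;
* `H0` = Pizer 1980 Thm. 2.25 (2.8) (`r = 0`, `k = 2`, `M` ARBITRARY prime to `p`; Hijikata–Saito 1973
  Lemma 1) in the tree's vocabulary — the hypothesis `hTr` of the tree THEOREM
  `BrandtJL.finrank_eigenLattice_eq_one_of_traceIdentity` (which carries NO square-free hypothesis).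
-/

noncomputable section

open scoped BigOperators ArithmeticFunction.sigma
open ArithmeticFunction

namespace Summit.ABC.ABC.Cruxes.DefiniteRTControlPrime.StubIdeas1G6

open Literature.NumberTheory.EllipticCurves Literature.NumberTheory.EllipticCurves.ModularForms
open Literature.NumberTheory.Automorphic Literature.NumberTheory.Automorphic.Brandt
open Literature.NumberTheory.Automorphic.HeckeTraceFormulaGL2Level
open Summit.ABC.ABC.Theses.DefiniteXi

/-! ### The three leaves -/

/-- **H2♭ (FACT-GRADE leaf; proposed name `takahashi2001_characterGroupDictionary_of_coprime`).**
The character-group dictionary at `r ∥ N`, `D = 1`, WITHOUT multiplicity one: verbatim `hDict` of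
`…PairwiseEisensteinProofs` minus its `finrank … = 1` conjunct.  Sources (all at ARBITRARY cofactor
`M`, already cited for `takahashi2001_thm_2_3_of_coprime`): Kohel 2001 Thm. 4.3 (`D = 1`),
Conrad–Stein 2001 §2.1/§7.1, Ribet 1990 Prop. 3.1–3.3, SGA 7 IX 11.5. -/
def H2flat : Prop :=
  ∀ (W : WeierstrassCurve ℚ) [W.IsElliptic] (M r : ℕ) [NeZero (M * r)],
    r.Prime → M.Coprime r → W.conductorNorm ℤ = M * r →
    ∀ P : ModularParametrizationData W (M * r),
      (∀ (W' : WeierstrassCurve ℚ) [W'.IsElliptic], W'.conductorNorm ℤ = M * r →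
          ∀ P' : ModularParametrizationData W' (M * r),
          P'.f = P.f → P.modularDegree ≤ P'.modularDegree) →
      ∀ (S : Brandt.XiSetup M r) [Fintype (Brandt.ClassSet S.O)],
        ∃ (X : Submodule ℤ (Brandt.ClassSet S.O → ℤ)) (pb : ℤ →ₗ[ℤ] X) (pf : X →ₗ[ℤ] ℤ),
          (∀ (a : ℤ) (y : X),
              ∑ i, (Brandt.weight S.O i : ℤ) * (pb a : Brandt.ClassSet S.O → ℤ) i *
                  (y : Brandt.ClassSet S.O → ℤ) i =
                ((W.minimalDiscriminantNorm ℤ).factorization r : ℤ) * a * pf y) ∧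
          (∀ a : ℤ, pf (pb a) = (P.modularDegree : ℤ) * a) ∧
          Function.Surjective pf ∧
          (∀ (m : ℤ) (v : Brandt.ClassSet S.O → ℤ), m ≠ 0 → m • v ∈ X → v ∈ X) ∧
          (∀ v : Brandt.ClassSet S.O → ℤ, ∑ i, v i = 0 → v ∈ X) ∧
          (pb 1 : Brandt.ClassSet S.O → ℤ) ∈
            Brandt.eigenLattice (M * r) (Brandt.matrix S.O) (fun n => W.LFunction n)

/-- **H1 (THEOREM-GRADE leaf; proposed name `takahashi2001_brandtEigenLattice_rank_one_of_coprime`).**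
`takahashi2001_brandtEigenLattice_rank_one` with `Squarefree (M * r)` ↦ `M.Coprime r`
(= k1-gen2 `StubIdeas1.rankOneCoprime`, k3 `StubIdeas3.brandtEigenLattice_rank_one_of_coprime`). -/
def H1 : Prop :=
  ∀ (W : WeierstrassCurve ℚ) [W.IsElliptic] (M r : ℕ) [NeZero (M * r)],
    r.Prime → M.Coprime r → W.conductorNorm ℤ = M * r →
    ∀ (_P : ModularParametrizationData W (M * r)) (S : Brandt.XiSetup M r)
      [Fintype (Brandt.ClassSet S.O)],
      Module.finrank ℤ
        (Brandt.eigenLattice (M * r) (Brandt.matrix S.O) (fun n => W.LFunction n)) = 1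

/-- **H0 (printed verbatim at arbitrary `M`; proposed name `pizer1980_thm_2_25_traceIdentity`).**
Pizer 1980 (J. Algebra 64) Thm. 2.25 (2.8), `r = 0`, `k = 2`: for `p` prime, `p ∤ M`, `O` Eichler of
level `M` in the definite algebra of discriminant `p`, `(n, pM) = 1`:
`tr T(n)|S₂(Γ₀(pM)) = tr B(n) − σ₁(n) + 2 tr T(n)|S₂(Γ₀(M))` (Remark 2.26: `r = 0` is Hijikata–Saito
1973 Lemma 1).  = k1-gen2 `StubIdeas1.traceIdentityCoprime` verbatim. -/
def H0 : Prop :=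
  ∀ (M r : ℕ) [NeZero M] [NeZero (M * r)], r.Prime → M.Coprime r →
    ∀ (S : Brandt.XiSetup M r) [Fintype (Brandt.ClassSet S.O)], ∀ n : ℕ, 0 < n → n.Coprime (M * r) →
      cuspidalHeckeTrace (M * r) 2 1 n =
        (((Brandt.matrix S.O n).trace : ℤ) : ℂ) - ((σ 1 n : ℕ) : ℂ) + 2 * cuspidalHeckeTrace M 2 1 n

/-- **H2 = `hDict` verbatim (the shape the tree's consumer eats).** -/
def H2 : Prop :=
  ∀ (W : WeierstrassCurve ℚ) [W.IsElliptic] (M r : ℕ) [NeZero (M * r)],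
    r.Prime → M.Coprime r → W.conductorNorm ℤ = M * r →
    ∀ P : ModularParametrizationData W (M * r),
      (∀ (W' : WeierstrassCurve ℚ) [W'.IsElliptic], W'.conductorNorm ℤ = M * r →
          ∀ P' : ModularParametrizationData W' (M * r),
          P'.f = P.f → P.modularDegree ≤ P'.modularDegree) →
      ∀ (S : Brandt.XiSetup M r) [Fintype (Brandt.ClassSet S.O)],
        ∃ (X : Submodule ℤ (Brandt.ClassSet S.O → ℤ)) (pb : ℤ →ₗ[ℤ] X) (pf : X →ₗ[ℤ] ℤ),
          (∀ (a : ℤ) (y : X),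
              ∑ i, (Brandt.weight S.O i : ℤ) * (pb a : Brandt.ClassSet S.O → ℤ) i *
                  (y : Brandt.ClassSet S.O → ℤ) i =
                ((W.minimalDiscriminantNorm ℤ).factorization r : ℤ) * a * pf y) ∧
          (∀ a : ℤ, pf (pb a) = (P.modularDegree : ℤ) * a) ∧
          Function.Surjective pf ∧
          (∀ (m : ℤ) (v : Brandt.ClassSet S.O → ℤ), m ≠ 0 → m • v ∈ X → v ∈ X) ∧
          (∀ v : Brandt.ClassSet S.O → ℤ, ∑ i, v i = 0 → v ∈ X) ∧
          Module.finrank ℤ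
              (Brandt.eigenLattice (M * r) (Brandt.matrix S.O) (fun n => W.LFunction n)) = 1 ∧
          (pb 1 : Brandt.ClassSet S.O → ℤ) ∈
            Brandt.eigenLattice (M * r) (Brandt.matrix S.O) (fun n => W.LFunction n)

/-! ### Assemblies (all proved) -/

/-- **A1. H0 ⇒ H1** in three lines, by the tree theorem
`BrandtJL.finrank_eigenLattice_eq_one_of_traceIdentity` (Pizer 1980 Thm. 2.28 proof; no square-free
hypothesis anywhere in its signature). -/
theorem A1_rankOne_of_traceIdentity (h0 : H0) : H1 := by
  intro W _ M r _ hr hcop _hN P S _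
  haveI : NeZero M := ⟨fun hM => NeZero.ne (M * r) (by rw [hM, zero_mul])⟩
  exact BrandtJL.finrank_eigenLattice_eq_one_of_traceIdentity S (h0 M r hr hcop S) W hr.one_lt P

/-- **A2. H1 ∧ H2♭ ⇒ H2** (re-insert the rank-one conjunct). -/
theorem A2_dict_of_flat_of_rankOne (h1 : H1) (h2 : H2flat) : H2 := by
  intro W _ M r _ hr hcop hN P hmin S _
  obtain ⟨X, pb, pf, hadj, hδ, hsurj, hsat, hdeg, hmem⟩ := h2 W M r hr hcop hN P hmin S
  exact ⟨X, pb, pf, hadj, hδ, hsurj, hsat, hdeg, h1 W M r hr hcop hN P S, hmem⟩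

/-- **A3. H2 ⇒ the stub**, by the tree theorem
`Literature.NumberTheory.Automorphic.takahashi2001_thm_2_3_of_coprime_of_brandtDictionary`
(its `include hDict` binder is exactly `H2`). -/
theorem A3_stub_of_dict (h2 : H2) : takahashi2001_thm_2_3_of_coprime :=
  takahashi2001_thm_2_3_of_coprime_of_brandtDictionary h2

/-- **A4. The stub from the two leaves H1, H2♭.** -/
theorem A4_stub_of_rankOne_of_flat (h1 : H1) (h2 : H2flat) : takahashi2001_thm_2_3_of_coprime :=
  A3_stub_of_dict (A2_dict_of_flat_of_rankOne h1 h2)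

/-- **A5. The stub from the two PRINTED leaves H0 (Pizer (2.8)) and H2♭ (dictionary).** -/
theorem A5_stub_of_traceIdentity_of_flat (h0 : H0) (h2 : H2flat) :
    takahashi2001_thm_2_3_of_coprime :=
  A4_stub_of_rankOne_of_flat (A1_rankOne_of_traceIdentity h0) h2

/-- **A6. The crux from {H0, H2♭, Pasten 163, Pasten 6.8}** through the landed closer
`Theorems.DefiniteRTControlPrime.definiteRTControlPrime_of_facts` (p97354). -/
theorem A6_definiteRTControlPrime_of_leaves (h0 : H0) (h2 : H2flat)
    (h163 : PastenShimura2024_minimalDegree_le_163_mul) (h68 : PastenShimura2024_lemma_6_8) :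
    DefiniteRTControlPrime :=
  Theorems.DefiniteRTControlPrime.definiteRTControlPrime_of_facts
    (A5_stub_of_traceIdentity_of_flat h0 h2) h163 h68

/-! ### Sanity: the leaves are EXACT generalisations of the reviewed square-free pair -/

/-- **S1.** H2♭ specialises to the reviewed square-free fact `takahashi2001_characterGroupDictionary`
(drop the degree-zero clause; a square-free `M r` is coprime; all-data minimality implies
conductor-restricted minimality). -/
theorem S1_squarefreeDict_of_flat (h2 : H2flat) : takahashi2001_characterGroupDictionary := by
  intro W _ M r _ hr hsq hN P hmin S _
  obtain ⟨X, pb, pf, hadj, hδ, hsurj, hsat, -, hmem⟩ :=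
    h2 W M r hr (Nat.coprime_of_squarefree_mul hsq) hN P (fun W' _ _ P' hP' => hmin W' P' hP') S
  exact ⟨X, pb, pf, hadj, hδ, hsurj, hsat, hmem⟩

/-- **S2.** H1 specialises to the reviewed (and proved) `takahashi2001_brandtEigenLattice_rank_one`. -/
theorem S2_squarefreeRankOne_of_H1 (h1 : H1) : takahashi2001_brandtEigenLattice_rank_one := by
  intro W _ M r _ hr hsq hN P S _
  exact h1 W M r hr (Nat.coprime_of_squarefree_mul hsq) hN P S

/-- **S3.** Conversely H2 (= `hDict`) contains H2♭ (typing `hDict` whole, gen-5 style at `D = 1`,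
is the trust H2♭ plus multiplicity one). -/
theorem S3_flat_of_dict (h2 : H2) : H2flat := by
  intro W _ M r _ hr hcop hN P hmin S _
  obtain ⟨X, pb, pf, hadj, hδ, hsurj, hsat, hdeg, -, hmem⟩ := h2 W M r hr hcop hN P hmin S
  exact ⟨X, pb, pf, hadj, hδ, hsurj, hsat, hdeg, hmem⟩

/-! ### Refinement (gen 6, new): the ONE-SETUP dictionary and setup transport

The literature (Ribet 1990 Prop. 3.1, Buzzard 1997 Thm. 4.7, Kohel 2001, Deines 2014 Thm. 4.2.1)
identifies `X_r(J₀(Mr))` with the degree-zero divisors on the class set of ONE Eichler order of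
level `M` in THE definite quaternion algebra of discriminant `r`.  The `∀ S` in `hDict`/`H2flat`
additionally bundles "Brandt data of type `(M, r)` are canonical up to reindexing" — which the TREE
PROVES (`Brandt.XiSetup.exists_classSetEquiv`, `BrandtXiCanonical.lean`; Vignéras III §5 B).  So the
weakest faithful typing of the fact is the one-setup form `H2flatOne` below (shape = hypothesis of
the tree consumer `takahashi2001_thm_2_3_of_coprime_of_brandtDictionary_one'` minus its rank
conjunct, plus the degree-zero clause), and `H2flatOne → H2flat` is a PROVABLE, purely
finite-`ℤ`-linear transport (`TransportCore`, M-sized: push `X, pb, pf` through `v ↦ v ∘ ε⁻¹`;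
cf. `XiSetup.exists_reindex`, `XiSetup.comp_symm_mem_eigenLattice` in
`BrandtAtkinLehnerSignCanonical.lean`). -/

/-- **H2♭₁ (FACT-GRADE leaf, one-setup form).** For ONE Brandt setup `S₀` of type `(M, r)` (given
that one exists) the dictionary package exists. -/
def H2flatOne : Prop :=
  ∀ (W : WeierstrassCurve ℚ) [W.IsElliptic] (M r : ℕ) [NeZero (M * r)],
    r.Prime → M.Coprime r → W.conductorNorm ℤ = M * r →
    ∀ P : ModularParametrizationData W (M * r),
      (∀ (W' : WeierstrassCurve ℚ) [W'.IsElliptic], W'.conductorNorm ℤ = M * r →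
          ∀ P' : ModularParametrizationData W' (M * r),
          P'.f = P.f → P.modularDegree ≤ P'.modularDegree) →
      Nonempty (Brandt.XiSetup M r) →
      ∃ (S₀ : Brandt.XiSetup M r) (_ : Fintype (Brandt.ClassSet S₀.O))
        (X : Submodule ℤ (Brandt.ClassSet S₀.O → ℤ)) (pb : ℤ →ₗ[ℤ] X) (pf : X →ₗ[ℤ] ℤ),
          (∀ (a : ℤ) (y : X),
              ∑ i, (Brandt.weight S₀.O i : ℤ) * (pb a : Brandt.ClassSet S₀.O → ℤ) i *
                  (y : Brandt.ClassSet S₀.O → ℤ) i =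
                ((W.minimalDiscriminantNorm ℤ).factorization r : ℤ) * a * pf y) ∧
          (∀ a : ℤ, pf (pb a) = (P.modularDegree : ℤ) * a) ∧
          Function.Surjective pf ∧
          (∀ (m : ℤ) (v : Brandt.ClassSet S₀.O → ℤ), m ≠ 0 → m • v ∈ X → v ∈ X) ∧
          (∀ v : Brandt.ClassSet S₀.O → ℤ, ∑ i, v i = 0 → v ∈ X) ∧
          (pb 1 : Brandt.ClassSet S₀.O → ℤ) ∈
            Brandt.eigenLattice (M * r) (Brandt.matrix S₀.O) (fun n => W.LFunction n)

/-- **T0 `TransportCore` (HELPER, provable, M-sized, pure finite `ℤ`-linear algebra; no quaternions).**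
A dictionary package over an index type `ι` moves along a bijection `ε : ι ≃ κ` matching the weights
and the matrices (`w' (ε c) = w c`, `B' n (ε c) (ε d) = B n c d`): take `X' = {v ∘ ε⁻¹ | v ∈ X}`
(`LinearEquiv.funCongrLeft ℤ ℤ ε.symm`), `pb' = that ∘ pb`, `pf' = pf ∘ inverse`; sums reindex by
`Fintype.sum_equiv`, eigen-membership by `Matrix.submatrix_mulVec_equiv`
(tree: `Brandt.reindex_mulVec_comp_symm`). -/
def TransportCore : Prop :=
  ∀ (ι κ : Type) [Fintype ι] [Fintype κ] (ε : ι ≃ κ) (w : ι → ℕ) (w' : κ → ℕ)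
    (B : ℕ → Matrix ι ι ℤ) (B' : ℕ → Matrix κ κ ℤ),
    (∀ c, w' (ε c) = w c) → (∀ n c d, B' n (ε c) (ε d) = B n c d) →
    ∀ (cst δ : ℤ) (N : ℕ) (lam : ℕ → ℤ) (X : Submodule ℤ (ι → ℤ)) (pb : ℤ →ₗ[ℤ] X)
      (pf : X →ₗ[ℤ] ℤ),
      (∀ (a : ℤ) (y : X), ∑ i, (w i : ℤ) * (pb a : ι → ℤ) i * (y : ι → ℤ) i = cst * a * pf y) →
      (∀ a : ℤ, pf (pb a) = δ * a) → Function.Surjective pf →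
      (∀ (m : ℤ) (v : ι → ℤ), m ≠ 0 → m • v ∈ X → v ∈ X) →
      (∀ v : ι → ℤ, ∑ i, v i = 0 → v ∈ X) →
      (pb 1 : ι → ℤ) ∈ Brandt.eigenLattice N B lam →
      ∃ (X' : Submodule ℤ (κ → ℤ)) (pb' : ℤ →ₗ[ℤ] X') (pf' : X' →ₗ[ℤ] ℤ),
        (∀ (a : ℤ) (y : X'), ∑ i, (w' i : ℤ) * (pb' a : κ → ℤ) i * (y : κ → ℤ) i = cst * a * pf' y) ∧
        (∀ a : ℤ, pf' (pb' a) = δ * a) ∧ Function.Surjective pf' ∧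
        (∀ (m : ℤ) (v : κ → ℤ), m ≠ 0 → m • v ∈ X' → v ∈ X') ∧
        (∀ v : κ → ℤ, ∑ i, v i = 0 → v ∈ X') ∧
        (pb' 1 : κ → ℤ) ∈ Brandt.eigenLattice N B' lam

/-- **A7. H1 ∧ H2♭₁ ⇒ the stub** directly, by the tree consumer
`takahashi2001_thm_2_3_of_coprime_of_brandtDictionary_one'` (`TakahashiDegreeFormulaCoprimeProofs.lean`). -/
theorem A7_stub_of_rankOne_of_flatOne (h1 : H1) (h2 : H2flatOne) :
    takahashi2001_thm_2_3_of_coprime := by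
  refine takahashi2001_thm_2_3_of_coprime_of_brandtDictionary_one'
    fun W _ M r _ hr hcop hN P hmin hne => ?_
  obtain ⟨S₀, hF, X, pb, pf, hadj, hδ, hsurj, hsat, -, hmem⟩ := h2 W M r hr hcop hN P hmin hne
  exact ⟨S₀, hF, X, pb, pf, hadj, hδ, hsurj, hsat, h1 W M r hr hcop hN P S₀, hmem⟩

/-- **A8. Setup transport: `TransportCore ∧ H2♭₁ ⇒ H2♭`** (so the one-setup fact feeds ALL six
`include hDict` consumers of `…PairwiseEisensteinProofs` once `H1` is in), by
`Brandt.XiSetup.exists_classSetEquiv`. -/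
theorem A8_flat_of_flatOne_of_transport (hT : TransportCore) (h2 : H2flatOne) : H2flat := by
  intro W _ M r _ hr hcop hN P hmin S _
  obtain ⟨S₀, hF, X, pb, pf, hadj, hδ, hsurj, hsat, hdeg, hmem⟩ := h2 W M r hr hcop hN P hmin ⟨S⟩
  obtain ⟨ε, hw, hB⟩ := S₀.exists_classSetEquiv S
  exact hT (Brandt.ClassSet S₀.O) (Brandt.ClassSet S.O) ε (Brandt.weight S₀.O) (Brandt.weight S.O)
    (Brandt.matrix S₀.O) (Brandt.matrix S.O) hw hB _ _ (M * r) (fun n => W.LFunction n) X pb pf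
    hadj hδ hsurj hsat hdeg hmem

/-- **A9. The stub from {H0, H2♭₁}** (no transport needed for the stub itself). -/
theorem A9_stub_of_traceIdentity_of_flatOne (h0 : H0) (h2 : H2flatOne) :
    takahashi2001_thm_2_3_of_coprime :=
  A7_stub_of_rankOne_of_flatOne (A1_rankOne_of_traceIdentity h0) h2

/-- **S4.** `H2♭ ⇒ H2♭₁` (the one-setup form is weaker). -/
theorem S4_flatOne_of_flat (h2 : H2flat) : H2flatOne := by
  intro W _ M r _ hr hcop hN P hmin hne
  obtain ⟨S⟩ := hne
  letI := Fintype.ofFinite (Brandt.ClassSet S.O)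
  obtain ⟨X, pb, pf, h⟩ := h2 W M r hr hcop hN P hmin S
  exact ⟨S, inferInstance, X, pb, pf, h⟩

/-- **T0 is a theorem** (so `H2flatOne` is a drop-in replacement for `H2flat`): transport of a
dictionary package along a weight- and matrix-matching bijection of index sets. [folklore] -/
theorem transportCore_holds : TransportCore := by
  intro ι κ _ _ ε w w' B B' hw hB cst δ N lam X pb pf hadj hδ hsurj hsat hdeg hmem
  -- the reindexing linear equivalence `v ↦ v ∘ ε⁻¹`
  let e : (ι → ℤ) ≃ₗ[ℤ] (κ → ℤ) := LinearEquiv.funCongrLeft ℤ ℤ ε.symm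
  have he : ∀ (v : ι → ℤ) (k : κ), e v k = v (ε.symm k) := fun v k => rfl
  have hes : ∀ (v : κ → ℤ) (c : ι), e.symm v c = v (ε c) := fun v c => rfl
  refine ⟨X.map (e : (ι → ℤ) →ₗ[ℤ] (κ → ℤ)), (e.submoduleMap X).toLinearMap ∘ₗ pb,
    pf ∘ₗ (e.submoduleMap X).symm.toLinearMap, ?_, ?_, ?_, ?_, ?_, ?_⟩
  · -- the weighted pairing reindexes along `ε`
    intro a y
    have hy : (y : κ → ℤ) = e (((e.submoduleMap X).symm y : X) : ι → ℤ) := by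
      rw [LinearEquiv.submoduleMap_symm_apply, LinearEquiv.apply_symm_apply]
    have hpb : ((((e.submoduleMap X).toLinearMap ∘ₗ pb) a : X.map (e : (ι → ℤ) →ₗ[ℤ] (κ → ℤ))) :
        κ → ℤ) = e (pb a : ι → ℤ) := by
      rw [LinearMap.comp_apply, LinearEquiv.coe_toLinearMap, LinearEquiv.submoduleMap_apply]
    calc ∑ k, (w' k : ℤ) * ((((e.submoduleMap X).toLinearMap ∘ₗ pb) a :
            X.map (e : (ι → ℤ) →ₗ[ℤ] (κ → ℤ))) : κ → ℤ) k * (y : κ → ℤ) k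
        = ∑ c, (w c : ℤ) * (pb a : ι → ℤ) c * (((e.submoduleMap X).symm y : X) : ι → ℤ) c := by
          rw [hpb, hy]
          exact (Fintype.sum_equiv ε _ _ fun c => by
            rw [hw c, he, he, Equiv.symm_apply_apply]).symm
      _ = cst * a * pf ((e.submoduleMap X).symm y) := hadj a _
      _ = cst * a * (pf ∘ₗ (e.submoduleMap X).symm.toLinearMap) y := rfl
  · intro a
    rw [LinearMap.comp_apply, LinearMap.comp_apply, LinearEquiv.coe_toLinearMap,
      LinearEquiv.coe_toLinearMap, LinearEquiv.symm_apply_apply]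
    exact hδ a
  · rw [LinearMap.coe_comp, LinearEquiv.coe_toLinearMap]
    exact hsurj.comp (e.submoduleMap X).symm.surjective
  · intro m v hm hmv
    rw [Submodule.mem_map_equiv] at hmv ⊢
    rw [map_smul] at hmv
    exact hsat m _ hm hmv
  · intro v hv
    rw [Submodule.mem_map_equiv]
    refine hdeg _ ?_
    calc ∑ c, e.symm v c = ∑ k, v k := Fintype.sum_equiv ε _ _ fun c => hes v c
      _ = 0 := hv
  · have hpb1 : ((((e.submoduleMap X).toLinearMap ∘ₗ pb) 1 : X.map (e : (ι → ℤ) →ₗ[ℤ] (κ → ℤ))) :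
        κ → ℤ) = (pb 1 : ι → ℤ) ∘ ε.symm := by
      rw [LinearMap.comp_apply, LinearEquiv.coe_toLinearMap, LinearEquiv.submoduleMap_apply]
      rfl
    rw [hpb1]
    intro p hp hpN
    have hB' : B' p = Matrix.reindex ε ε (B p) := by
      ext a b
      rw [Matrix.reindex_apply, Matrix.submatrix_apply, ← hB p (ε.symm a) (ε.symm b),
        Equiv.apply_symm_apply, Equiv.apply_symm_apply]
    rw [hB', Brandt.reindex_mulVec_comp_symm, hmem p hp hpN]
    rfl

/-- **A10. Hence `H2♭₁ ⇒ H2♭` outright**, and the one-setup fact feeds every `∀ S` consumer. -/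
theorem A10_flat_of_flatOne (h2 : H2flatOne) : H2flat :=
  A8_flat_of_flatOne_of_transport transportCore_holds h2

/-- **A11. The crux from {H0, H2♭₁, Pasten 163, Pasten 6.8}.** -/
theorem A11_definiteRTControlPrime_of_leavesOne (h0 : H0) (h2 : H2flatOne)
    (h163 : PastenShimura2024_minimalDegree_le_163_mul) (h68 : PastenShimura2024_lemma_6_8) :
    DefiniteRTControlPrime :=
  A6_definiteRTControlPrime_of_leaves h0 (A10_flat_of_flatOne h2) h163 h68

end Summit.ABC.ABC.Cruxes.DefiniteRTControlPrime.StubIdeas1G6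

end
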